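import Literature.Barriers.AtomisticToContinuum.HardDiskDeformation
import Mathlib.Topology.MetricSpace.Lipschitz
import Mathlib.Analysis.Convex.Basic
import Mathlib.Topology.Order.OrderClosed
import HarnessLib

/-!
# Lemma 15 of Richthammer 2007: `τ_n(|·|) ∧ m_{x',t}` is `1/2`-Lipschitz along `e₁`

Sequel to `HardDiskDeformation.lean` (provefact `Richthammer2007_ineq35`; the field `lipschitz`
of `ShearCells.Admissible` for the concrete translation systems). Richthammer's Lemma 15
[Richthammer2007, §6.2, p. 13]: "For `x' ∈ ℝ²` and `t ∈ ℝ` the function `τ_n(|.|) ∧ m_{x',t}`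
is `1/2`-`e₁`-Lipschitz-continuous and piecewise continuously `e₁`-differentiable", with the
printed argument for the only delicate point, continuity across the jump of `m_{x',t}` to `+∞`:
"if `x ∈ ∂{m_{x',t} < ∞} = ∂{f_K(. - x') < 1}` then `x - x'` is contained in the closure of
`K_ε`. Hence `|x - x'| ≤ c_K`, which implies `|x'| - c_K ≤ |x|`. As `τ_n` is decreasing we obtain
`τ_n(|x|) ≤ τ_n(|x'| - c_K) ≤ t + h_{x',t} ≤ m_{x',t}(x)`". We prove the Lipschitz half (the
differentiability half is not needed: the change of variables of
`Literature/MeasureTheory/Lebesgue/` works with `seqDeriv`):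

* `capAux P x' t = τ_n(|·|) ∧ m_{x',t}` as a real function (`coe_capAux`: it is the `EReal`
  infimum `baseShift ⊓ mAux`), `capAux_nonneg`, `capAux_le_baseShift`;
* generic tools: `lipschitzWith_of_Iic_Icc_Ici` (gluing three Lipschitz pieces of the line),
  `abs_ciInf_sub_ciInf_le` / `iInf_coe_eq_coe_ciInf` (infima of uniformly Lipschitz families,
  Lemma 14 (a) for arbitrary families);
* `one_le_QFun` (`Q(k) ≥ 1` for `k ≥ 1`) and `abs_prof_sub_prof_le` (`τ_n` is `τ`-Lipschitz for
  `n ≥ R + 1`), `lipschitz_baseShift_line` (`τ_n(|·|)` is `1/2`-Lipschitz along `e₁` for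
  `τ ≤ 1/2`);
* **`lipschitz_capAux_line`** — Lemma 15: for `ε > 0`, `0 ≤ τ ≤ 1/2`, `R + 1 ≤ n`, every
  `x'`, `t`, `y₀`, the function `r ↦ capAux P x' t (y₀ + r e₁)` is `1/2`-Lipschitz.

## References

* [Richthammer2007] T. Richthammer, *Translation-invariance of two-dimensional Gibbsian point
  processes*, Comm. Math. Phys. 274 (2007) 81–122, arXiv:0706.3637: §6.2 Lemmas 14–15 (p. 13).
-/

noncomputable section

open MeasureTheory Set Function Filter
open scoped ENNReal NNReal Topology

namespace Literature.Barriers.AtomisticToContinuum.HardDisk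

open Literature.Analysis.FunctionSpaces

/-! ### Generic tools -/

/-- **Gluing Lipschitz pieces of the line**: a function which is `L`-Lipschitz on `]-∞, a]`,
on `[a, b]` and on `[b, ∞[` (`a ≤ b`) is `L`-Lipschitz. [folklore] -/
theorem lipschitzWith_of_Iic_Icc_Ici {f : ℝ → ℝ} {L : ℝ≥0} {a b : ℝ} (hab : a ≤ b)
    (h₁ : ∀ x ∈ Iic a, ∀ y ∈ Iic a, |f x - f y| ≤ L * |x - y|)
    (h₂ : ∀ x ∈ Icc a b, ∀ y ∈ Icc a b, |f x - f y| ≤ L * |x - y|)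
    (h₃ : ∀ x ∈ Ici b, ∀ y ∈ Ici b, |f x - f y| ≤ L * |x - y|) :
    LipschitzWith L f := by
  refine LipschitzWith.of_dist_le_mul fun x y => ?_
  rw [Real.dist_eq, Real.dist_eq]
  wlog hxy : x ≤ y generalizing x y
  · rw [abs_sub_comm, abs_sub_comm x y]; exact this y x (le_of_not_ge hxy)
  have hL : (0 : ℝ) ≤ L := L.2
  -- chaining through an intermediate point
  have chain : ∀ p q r : ℝ, p ≤ q → q ≤ r → |f p - f q| ≤ L * |p - q| → |f q - f r| ≤ L * |q - r| →
      |f p - f r| ≤ L * |p - r| := by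
    intro p q r hpq hqr h1 h2
    calc |f p - f r| ≤ |f p - f q| + |f q - f r| := abs_sub_le _ _ _
      _ ≤ L * |p - q| + L * |q - r| := add_le_add h1 h2
      _ = L * |p - r| := by
          rw [abs_of_nonpos (sub_nonpos.2 hpq), abs_of_nonpos (sub_nonpos.2 hqr),
            abs_of_nonpos (sub_nonpos.2 (hpq.trans hqr))]
          ring
  rcases le_total y a with hya | hay
  · exact h₁ x (hxy.trans hya) y hya
  rcases le_total x a with hxa | hax
  · rcases le_total y b with hyb | hby
    · exact chain x a y hxa hay (h₁ x hxa a Set.self_mem_Iic) (h₂ a ⟨le_rfl, hab⟩ y ⟨hay, hyb⟩)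
    · exact chain x b y (hxa.trans hab) hby
        (chain x a b hxa hab (h₁ x hxa a Set.self_mem_Iic) (h₂ a ⟨le_rfl, hab⟩ b ⟨hab, le_rfl⟩))
        (h₃ b Set.self_mem_Ici y hby)
  · rcases le_total x b with hxb | hbx
    · rcases le_total y b with hyb | hby
      · exact h₂ x ⟨hax, hxb⟩ y ⟨hay, hyb⟩
      · exact chain x b y hxb hby (h₂ x ⟨hax, hxb⟩ b ⟨hab, le_rfl⟩) (h₃ b Set.self_mem_Ici y hby)
    · exact h₃ x hbx y (hbx.trans hxy)

/-- **Infima of uniformly close families are close** (Lemma 14 (a) for arbitrary bounded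
families). [cite: Richthammer2007, §6.2 Lemma 14 (a) (p. 13)] -/
theorem abs_ciInf_sub_ciInf_le {ι : Type*} [Nonempty ι] {g g' : ι → ℝ} {C : ℝ}
    (hb : BddBelow (Set.range g)) (hb' : BddBelow (Set.range g')) (h : ∀ i, |g i - g' i| ≤ C) :
    |(⨅ i, g i) - ⨅ i, g' i| ≤ C := by
  rw [abs_le]
  constructor
  · -- `⨅ g' - C ≤ ⨅ g`
    have : (⨅ i, g' i) - C ≤ ⨅ i, g i :=
      le_ciInf fun i => by
        have h1 := ciInf_le hb' i
        have h2 := (abs_le.1 (h i)).1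
        linarith
    linarith
  · have : (⨅ i, g i) - C ≤ ⨅ i, g' i :=
      le_ciInf fun i => by
        have h1 := ciInf_le hb i
        have h2 := (abs_le.1 (h i)).2
        linarith
    linarith

/-- **The `EReal` infimum of a bounded-below nonempty real family is its real infimum.**
[folklore] -/
theorem iInf_coe_eq_coe_ciInf {ι : Type*} [Nonempty ι] {g : ι → ℝ} (hb : BddBelow (Set.range g)) :
    ⨅ i, (g i : EReal) = ((⨅ i, g i : ℝ) : EReal) := by
  apply le_antisymm
  · -- the `EReal` infimum is a real number `r ≥ ⨅ g`; if it were larger, some `g i < r`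
    obtain ⟨i₀⟩ := ‹Nonempty ι›
    set v : EReal := ⨅ i, (g i : EReal) with hv
    have hvtop : v ≠ ⊤ := ne_top_of_le_ne_top (EReal.coe_ne_top _) (iInf_le _ i₀)
    have hvge : ((⨅ i, g i : ℝ) : EReal) ≤ v :=
      le_iInf fun i => EReal.coe_le_coe_iff.2 (ciInf_le hb i)
    have hvbot : v ≠ ⊥ := ne_bot_of_le_ne_bot (EReal.coe_ne_bot _) hvge
    obtain ⟨r, hr⟩ : ∃ r : ℝ, (r : EReal) = v := ⟨v.toReal, EReal.coe_toReal hvtop hvbot⟩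
    rw [← hr]
    refine EReal.coe_le_coe_iff.2 (le_of_not_gt fun hlt => ?_)
    obtain ⟨i, hi⟩ := exists_lt_of_ciInf_lt hlt
    have h1 : v ≤ (g i : EReal) := iInf_le _ i
    rw [← hr, EReal.coe_le_coe_iff] at h1
    exact absurd hi (not_lt.2 h1)
  · exact le_iInf fun i => EReal.coe_le_coe_iff.2 (ciInf_le hb i)

/-! ### `Q ≥ 1` and the Lipschitz constant of `τ_n` -/

/-- `Q(1) = 1` (as `q = 1` on `[0, 1]`). [cite: Richthammer2007, §5.2 (p. 11)] -/
theorem QFun_one : QFun 1 = 1 := by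
  unfold QFun
  rw [intervalIntegral.integral_congr (g := fun _ => (1 : ℝ)) (fun s hs => ?_)]
  · simp
  · rw [Set.uIcc_of_le zero_le_one] at hs
    exact qFun_eq_one_of_le_one hs.1 hs.2

/-- **`Q(k) ≥ 1` for `k ≥ 1`.** [cite: Richthammer2007, §5.2 (p. 11)] -/
theorem one_le_QFun {k : ℝ} (hk : 1 ≤ k) : 1 ≤ QFun k := by
  rw [← QFun_one]; exact QFun_mono hk

namespace DeformData

variable {P : DeformData}

/-- **`τ_n` is `τ`-Lipschitz** once `n ≥ R + 1` (from (6.15) and `Q(n - R) ≥ 1`).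
[cite: Richthammer2007, §6.8 (6.15) (p. 17)] -/
theorem abs_prof_sub_prof_le (hτ : 0 ≤ P.τ) (hRn : P.R + 1 ≤ P.n) (s s' : ℝ) :
    |P.prof s - P.prof s'| ≤ P.τ * |s - s'| := by
  have hRn' : (P.R : ℝ) < P.n := by exact_mod_cast Nat.lt_of_succ_le hRn
  have hQ : 1 ≤ QFun ((P.n : ℝ) - P.R) := one_le_QFun (by
    have : ((P.R + 1 : ℕ) : ℝ) ≤ P.n := by exact_mod_cast hRn
    push_cast at this; linarith)
  calc |P.prof s - P.prof s'| ≤ P.τ * |s - s'| / QFun ((P.n : ℝ) - P.R) :=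
        abs_tProfile_sub_le hτ hRn' s s'
    _ ≤ P.τ * |s - s'| := div_le_self (by positivity) hQ

/-! ### Geometry of the line `y₀ + ℝ e₁` -/

/-- The maximum norm of `a e₁` is `|a|`. [folklore] -/
theorem supNorm_smul_single (a : ℝ) : supNorm (a • EuclideanSpace.single (0 : Fin 2) (1 : ℝ)) = |a| := by
  apply le_antisymm
  · refine supNorm_le_of_forall (abs_nonneg a) fun i => ?_
    fin_cases i <;> simp
  · have h := abs_apply_le_supNorm (a • EuclideanSpace.single (0 : Fin 2) (1 : ℝ)) 0
    simpa using h

/-- Moving along `e₁` changes the maximum norm by at most the distance moved. [folklore] -/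
theorem abs_supNorm_line_sub_le (y₀ : EuclideanSpace ℝ (Fin 2)) (r r' : ℝ) :
    |supNorm (y₀ + r • EuclideanSpace.single (0 : Fin 2) (1 : ℝ)) -
        supNorm (y₀ + r' • EuclideanSpace.single (0 : Fin 2) (1 : ℝ))| ≤ |r - r'| := by
  have key : ∀ a b : ℝ, supNorm (y₀ + a • EuclideanSpace.single (0 : Fin 2) (1 : ℝ)) -
      supNorm (y₀ + b • EuclideanSpace.single (0 : Fin 2) (1 : ℝ)) ≤ |a - b| := by
    intro a b
    have h := supNorm_sub_le (y₀ + a • EuclideanSpace.single (0 : Fin 2) (1 : ℝ))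
      (y₀ + b • EuclideanSpace.single (0 : Fin 2) (1 : ℝ))
    have e : y₀ + a • EuclideanSpace.single (0 : Fin 2) (1 : ℝ) -
        (y₀ + b • EuclideanSpace.single (0 : Fin 2) (1 : ℝ)) =
        (a - b) • EuclideanSpace.single (0 : Fin 2) (1 : ℝ) := by
      rw [sub_smul]; abel
    rw [e, supNorm_smul_single] at h
    linarith
  rw [abs_le]
  constructor
  · have := key r' r
    rw [abs_sub_comm] at this
    linarith
  · exact key r r'

/-- **`t⁰ = τ_n(|·|)` is `1/2`-Lipschitz along `e₁`** (for `0 ≤ τ ≤ 1/2`, `n ≥ R + 1`).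
[cite: Richthammer2007, §6.2 Lemma 15 (p. 13)] -/
theorem lipschitz_baseShift_line (hτ : 0 ≤ P.τ) (hτ2 : P.τ ≤ 1 / 2) (hRn : P.R + 1 ≤ P.n)
    (y₀ : EuclideanSpace ℝ (Fin 2)) :
    LipschitzWith (1 / 2 : ℝ≥0) fun r : ℝ =>
      P.baseShift (y₀ + r • EuclideanSpace.single (0 : Fin 2) (1 : ℝ)) := by
  refine LipschitzWith.of_dist_le_mul fun r r' => ?_
  rw [Real.dist_eq, Real.dist_eq]
  unfold baseShift
  calc |P.prof (supNorm (y₀ + r • EuclideanSpace.single 0 1)) -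
        P.prof (supNorm (y₀ + r' • EuclideanSpace.single 0 1))|
      ≤ P.τ * |supNorm (y₀ + r • EuclideanSpace.single 0 1) -
          supNorm (y₀ + r' • EuclideanSpace.single 0 1)| := abs_prof_sub_prof_le hτ hRn _ _
    _ ≤ (1 / 2) * |r - r'| := by
        have h := abs_supNorm_line_sub_le y₀ r r'
        have : P.τ * |supNorm (y₀ + r • EuclideanSpace.single 0 1) -
            supNorm (y₀ + r' • EuclideanSpace.single 0 1)| ≤ P.τ * |r - r'| :=
          mul_le_mul_of_nonneg_left h hτ
        nlinarith [abs_nonneg (r - r')]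
    _ = ((1 / 2 : ℝ≥0) : ℝ) * |r - r'| := by norm_num

/-! ### The capped auxiliary function `τ_n(|·|) ∧ m_{x',t}` -/

variable (P) in
/-- `τ_n(|·|) ∧ m_{x',t}` as a real function. [cite: Richthammer2007, §6.2 Lemma 15 (p. 13)] -/
def capAux (x' : EuclideanSpace ℝ (Fin 2)) (t : ℝ) (y : EuclideanSpace ℝ (Fin 2)) : ℝ :=
  if 1 / 2 < P.hAux x' t * cF P.ε then min (P.baseShift y) t
  else if fK P.ε (y - x') = 1 then P.baseShift y
  else min (P.baseShift y) (t + P.hAux x' t * fK P.ε (y - x'))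

variable (P) in
/-- `(t⁰ ⊓ m_{x',t})(y)` computed in `EReal` is the real number `capAux P x' t y`.
[cite: Richthammer2007, §6.2 Lemma 15 (p. 13)] -/
theorem coe_capAux (x' : EuclideanSpace ℝ (Fin 2)) (t : ℝ) (y : EuclideanSpace ℝ (Fin 2)) :
    (P.baseShift y : EReal) ⊓ P.mAux x' t y = (P.capAux x' t y : EReal) := by
  unfold capAux mAux
  split_ifs with h1 h2
  · exact (EReal.coe_strictMono.monotone.map_min).symm
  · exact inf_top_eq _
  · exact (EReal.coe_strictMono.monotone.map_min).symm

variable (P) in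
/-- `τ_n(|·|) ∧ m_{x',t} ≤ τ_n(|·|)`. [folklore] -/
theorem capAux_le_baseShift (x' : EuclideanSpace ℝ (Fin 2)) (t : ℝ) (y : EuclideanSpace ℝ (Fin 2)) :
    P.capAux x' t y ≤ P.baseShift y := by
  unfold capAux
  split_ifs
  · exact min_le_left _ _
  · exact le_rfl
  · exact min_le_left _ _

/-- `τ_n(|·|) ∧ m_{x',t} ≥ 0` for `t ≥ 0` (and `τ ≥ 0`, `R < n`). [folklore] -/
theorem capAux_nonneg (hτ : 0 ≤ P.τ) (hRn : P.R < P.n) (x' : EuclideanSpace ℝ (Fin 2)) {t : ℝ}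
    (ht : 0 ≤ t) (y : EuclideanSpace ℝ (Fin 2)) : 0 ≤ P.capAux x' t y := by
  have hb := (baseShift_mem_Icc hτ hRn y).1
  unfold capAux
  split_ifs
  · exact le_min hb ht
  · exact hb
  · exact le_min hb (add_nonneg ht (mul_nonneg (P.hAux_nonneg x' t) (fK_nonneg _ _)))

/-- **The boundary inequality** of the proof of Lemma 15: where `f_K(y - x') = 1`... is NOT
available in general, but where `|y - x'|₂ ≤ c_K` one has `τ_n(|y|) ≤ τ_n(|x'| - c_K) ≤
t + h_{x',t}`. [cite: Richthammer2007, §6.2 (p. 13, proof of Lemma 15)] -/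
theorem baseShift_le_add_hAux (hτ : 0 ≤ P.τ) (hRn : P.R < P.n) {x' y : EuclideanSpace ℝ (Fin 2)}
    (hy : ‖y - x'‖ ≤ P.cK) (t : ℝ) : P.baseShift y ≤ t + P.hAux x' t := by
  have hRn' : (P.R : ℝ) < P.n := by exact_mod_cast hRn
  -- `|x'| - c_K ≤ |y|`
  have h1 : supNorm x' - P.cK ≤ supNorm y := by
    have h := supNorm_sub_le x' y
    have h' : supNorm (x' - y) ≤ P.cK := by
      calc supNorm (x' - y) ≤ ‖x' - y‖ := supNorm_le_norm _
        _ = ‖y - x'‖ := norm_sub_rev _ _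
        _ ≤ P.cK := hy
    linarith
  -- `τ_n` is decreasing
  have h2 : P.baseShift y ≤ P.prof (supNorm x' - P.cK) := tProfile_antitone hτ hRn' h1
  have h3 : P.prof (supNorm x' - P.cK) ≤ t + P.hAux x' t := by
    unfold hAux
    have := le_abs_self (P.prof (supNorm x' - P.cK) - t)
    linarith
  exact h2.trans h3

/-- **Lemma 15 (Lipschitz half).** For `ε > 0`, `0 ≤ τ ≤ 1/2`, `R + 1 ≤ n` and every `x'`, `t`,
`y₀`, the function `r ↦ (τ_n(|·|) ∧ m_{x',t})(y₀ + r e₁)` is `1/2`-Lipschitz. Proof as printed: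
in the first case `m ≡ t`; in the second, `m = t + h_{x',t} f_K(· - x')` has `e₁`-slope at most
`h_{x',t} c_f ≤ 1/2` on the open interval where `f_K(· - x') < 1`, the capped function equals
`τ_n(|·|)` outside it, and the two pieces agree at its endpoints by `baseShift_le_add_hAux`.
[cite: Richthammer2007, §6.2 Lemma 15 (p. 13)] -/
theorem lipschitz_capAux_line (hε : 0 < P.ε) (hτ : 0 ≤ P.τ) (hτ2 : P.τ ≤ 1 / 2)
    (hRn : P.R + 1 ≤ P.n) (x' : EuclideanSpace ℝ (Fin 2)) (t : ℝ) (y₀ : EuclideanSpace ℝ (Fin 2)) :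
    LipschitzWith (1 / 2 : ℝ≥0) fun r : ℝ =>
      P.capAux x' t (y₀ + r • EuclideanSpace.single (0 : Fin 2) (1 : ℝ)) := by
  have hRn0 : P.R < P.n := Nat.lt_of_succ_le hRn
  have hA := lipschitz_baseShift_line hτ hτ2 hRn y₀
  by_cases h1 : 1 / 2 < P.hAux x' t * cF P.ε
  · -- first case: `m ≡ t`
    have heq : (fun r : ℝ => P.capAux x' t (y₀ + r • EuclideanSpace.single (0 : Fin 2) (1 : ℝ))) =
        fun r => min (P.baseShift (y₀ + r • EuclideanSpace.single (0 : Fin 2) (1 : ℝ))) t := by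
      funext r
      unfold capAux
      rw [if_pos h1]
    rw [heq]
    exact hA.min_const t
  · -- second case
    push Not at h1
    set e₁ : EuclideanSpace ℝ (Fin 2) := EuclideanSpace.single (0 : Fin 2) (1 : ℝ) with he
    set A : ℝ → ℝ := fun r => P.baseShift (y₀ + r • e₁) with hAdef
    set B : ℝ → ℝ := fun r => t + P.hAux x' t * fK P.ε (y₀ + r • e₁ - x') with hBdef
    -- `B` is `1/2`-Lipschitz
    have hB : LipschitzWith (1 / 2 : ℝ≥0) B := by
      refine LipschitzWith.of_dist_le_mul fun r r' => ?_
      rw [Real.dist_eq, Real.dist_eq, hBdef]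
      simp only []
      have hdiff : |fK P.ε (y₀ + r • e₁ - x') - fK P.ε (y₀ + r' • e₁ - x')| ≤ cF P.ε * |r - r'| := by
        have h := abs_fK_sub_fK_le_axis hε (y₀ + r' • e₁) x' (r - r')
        have e : y₀ + r' • e₁ + (r - r') • EuclideanSpace.single 0 (1 : ℝ) - x' = y₀ + r • e₁ - x' := by
          rw [he, sub_smul]; abel
        rw [e] at h
        exact h
      have hh0 := P.hAux_nonneg x' t
      calc |t + P.hAux x' t * fK P.ε (y₀ + r • e₁ - x') - (t + P.hAux x' t * fK P.ε (y₀ + r' • e₁ - x'))|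
          = P.hAux x' t * |fK P.ε (y₀ + r • e₁ - x') - fK P.ε (y₀ + r' • e₁ - x')| := by
            rw [show t + P.hAux x' t * fK P.ε (y₀ + r • e₁ - x') -
              (t + P.hAux x' t * fK P.ε (y₀ + r' • e₁ - x')) =
              P.hAux x' t * (fK P.ε (y₀ + r • e₁ - x') - fK P.ε (y₀ + r' • e₁ - x')) by ring,
              abs_mul, abs_of_nonneg hh0]
        _ ≤ P.hAux x' t * (cF P.ε * |r - r'|) := mul_le_mul_of_nonneg_left hdiff hh0
        _ = (P.hAux x' t * cF P.ε) * |r - r'| := by ring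
        _ ≤ (1 / 2) * |r - r'| := mul_le_mul_of_nonneg_right h1 (abs_nonneg _)
        _ = ((1 / 2 : ℝ≥0) : ℝ) * |r - r'| := by norm_num
    have hAB : LipschitzWith (1 / 2 : ℝ≥0) fun r => min (A r) (B r) := by
      have h := hA.min hB
      rwa [max_self] at h
    -- the open set where `f_K < 1`
    set U : Set ℝ := {r | ‖y₀ + r • e₁ - x'‖ < 1 + P.ε} with hU
    have hcapU : ∀ r, r ∈ U → P.capAux x' t (y₀ + r • e₁) = min (A r) (B r) := fun r hr => by
      have hlt : fK P.ε (y₀ + r • e₁ - x') < 1 := (fK_lt_one_iff hε).2 hr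
      unfold capAux
      rw [if_neg (not_lt.2 h1), if_neg hlt.ne]
    have hcapUc : ∀ r, r ∉ U → P.capAux x' t (y₀ + r • e₁) = A r := fun r hr => by
      have hge : 1 + P.ε ≤ ‖y₀ + r • e₁ - x'‖ := not_lt.1 hr
      have h1' : fK P.ε (y₀ + r • e₁ - x') = 1 := fK_eq_one hε hge
      unfold capAux
      rw [if_neg (not_lt.2 h1), if_pos h1']
    -- on the closed set `‖·‖ ≤ 1 + ε` the two pieces are ordered: `A ≤ B` wherever `f_K = 1`
    have hAleB : ∀ r, ‖y₀ + r • e₁ - x'‖ ≤ 1 + P.ε → r ∉ U → A r ≤ B r := fun r hle hr => by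
      have hge : 1 + P.ε ≤ ‖y₀ + r • e₁ - x'‖ := not_lt.1 hr
      have h1' : fK P.ε (y₀ + r • e₁ - x') = 1 := fK_eq_one hε hge
      have := baseShift_le_add_hAux hτ hRn0 (x' := x') (y := y₀ + r • e₁) hle t
      simp only [hAdef, hBdef, h1', mul_one]
      exact this
    -- Lipschitz estimates in the form used by the gluing lemma
    have hA' : ∀ x y : ℝ, |A x - A y| ≤ (1 / 2 : ℝ≥0) * |x - y| := fun x y => by
      have h := hA.dist_le_mul x y
      rwa [Real.dist_eq, Real.dist_eq] at h
    have hAB' : ∀ x y : ℝ, |min (A x) (B x) - min (A y) (B y)| ≤ (1 / 2 : ℝ≥0) * |x - y| := fun x y => by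
      have h := hAB.dist_le_mul x y
      rwa [Real.dist_eq, Real.dist_eq] at h
    -- the target function
    have hgoal : (fun r : ℝ => P.capAux x' t (y₀ + r • EuclideanSpace.single (0 : Fin 2) (1 : ℝ))) =
        fun r => P.capAux x' t (y₀ + r • e₁) := rfl
    rw [hgoal]
    by_cases hne : U.Nonempty
    · -- `U` is a bounded open interval `]a, b[`
      have hUopen : IsOpen U := by
        have hc : Continuous fun r : ℝ => ‖y₀ + r • e₁ - x'‖ :=
          ((continuous_const.add (continuous_id.smul continuous_const)).sub continuous_const).norm
        exact isOpen_lt hc continuous_const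
      have hbound : ∀ r ∈ U, |r| ≤ ‖y₀ - x'‖ + (1 + P.ε) := fun r hr => by
        have h : ‖r • e₁‖ ≤ ‖y₀ + r • e₁ - x'‖ + ‖y₀ - x'‖ := by
          have := norm_sub_le (y₀ + r • e₁ - x') (y₀ - x')
          rw [show y₀ + r • e₁ - x' - (y₀ - x') = r • e₁ by abel] at this
          linarith [norm_sub_rev (y₀ + r • e₁ - x') (y₀ - x')]
        rw [he, norm_smul, Real.norm_eq_abs, PiLp.norm_single, norm_one, mul_one] at h
        have := hr
        simp only [hU, mem_setOf_eq] at this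
        linarith
      have hbdd_above : BddAbove U := ⟨‖y₀ - x'‖ + (1 + P.ε), fun r hr => (abs_le.1 (hbound r hr)).2⟩
      have hbdd_below : BddBelow U := ⟨-(‖y₀ - x'‖ + (1 + P.ε)), fun r hr => (abs_le.1 (hbound r hr)).1⟩
      set a := sInf U with ha
      set b := sSup U with hb
      have hab : a ≤ b := csInf_le_csSup (hb := hbdd_below) (ha := hbdd_above) hne
      -- convexity: `]a, b[ ⊆ U` (`U` is the preimage of a ball under an affine line)
      have hconv : Convex ℝ U := by
        have hpre : U = (AffineMap.lineMap (y₀ - x') (y₀ - x' + e₁) : ℝ →ᵃ[ℝ] EuclideanSpace ℝ (Fin 2)) ⁻¹'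
            Metric.ball (0 : EuclideanSpace ℝ (Fin 2)) (1 + P.ε) := by
          ext r
          simp only [hU, mem_setOf_eq, mem_preimage, Metric.mem_ball, dist_zero_right,
            AffineMap.lineMap_apply_module]
          have : (1 - r) • (y₀ - x') + r • (y₀ - x' + e₁) = y₀ + r • e₁ - x' := by
            rw [smul_add, sub_smul, one_smul]; abel
          rw [this]
        rw [hpre]
        exact (convex_ball (0 : EuclideanSpace ℝ (Fin 2)) (1 + P.ε)).affine_preimage _
      have hord : U.OrdConnected := (convex_iff_ordConnected.1 hconv)
      have hIoo : Ioo a b ⊆ U := fun r hr => by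
        obtain ⟨u, hu, hur⟩ := exists_lt_of_csInf_lt hne hr.1
        obtain ⟨v, hv, hrv⟩ := exists_lt_of_lt_csSup hne hr.2
        exact hord.out hu hv ⟨hur.le, hrv.le⟩
      have ha_notMem : a ∉ U := fun haU => by
        obtain ⟨δ, hδ, hball⟩ := Metric.isOpen_iff.1 hUopen a haU
        have : a - δ / 2 ∈ U := hball (by rw [Metric.mem_ball, Real.dist_eq]; rw [abs_of_nonpos] <;> linarith)
        have := csInf_le hbdd_below this
        linarith
      have hb_notMem : b ∉ U := fun hbU => by
        obtain ⟨δ, hδ, hball⟩ := Metric.isOpen_iff.1 hUopen b hbU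
        have : b + δ / 2 ∈ U := hball (by rw [Metric.mem_ball, Real.dist_eq]; rw [abs_of_nonneg] <;> linarith)
        have := le_csSup hbdd_above this
        linarith
      have hle_of_notMem_left : ∀ r, r ≤ a → r ∉ U := fun r hr hrU => by
        rcases hr.lt_or_eq with hlt | heq
        · exact absurd (csInf_le hbdd_below hrU) (not_le.2 hlt)
        · exact ha_notMem (heq ▸ hrU)
      have hge_of_notMem_right : ∀ r, b ≤ r → r ∉ U := fun r hr hrU => by
        rcases hr.lt_or_eq with hlt | heq
        · exact absurd (le_csSup hbdd_above hrU) (not_le.2 hlt)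
        · exact hb_notMem (heq ▸ hrU)
      -- the norm at `a` and `b` is exactly `1 + ε` (limits of points of `U`)
      have hnorm_a : ‖y₀ + a • e₁ - x'‖ ≤ 1 + P.ε := by
        have hc : Continuous fun r : ℝ => ‖y₀ + r • e₁ - x'‖ :=
          ((continuous_const.add (continuous_id.smul continuous_const)).sub continuous_const).norm
        have hmem : a ∈ closure U := csInf_mem_closure hne hbdd_below
        have hsub : closure U ⊆ {r | ‖y₀ + r • e₁ - x'‖ ≤ 1 + P.ε} :=
          closure_minimal (fun r hr => by
            simp only [hU, mem_setOf_eq] at hr ⊢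
            exact hr.le) (isClosed_le hc continuous_const)
        exact hsub hmem
      have hnorm_b : ‖y₀ + b • e₁ - x'‖ ≤ 1 + P.ε := by
        have hc : Continuous fun r : ℝ => ‖y₀ + r • e₁ - x'‖ :=
          ((continuous_const.add (continuous_id.smul continuous_const)).sub continuous_const).norm
        have hmem : b ∈ closure U := csSup_mem_closure hne hbdd_above
        have hsub : closure U ⊆ {r | ‖y₀ + r • e₁ - x'‖ ≤ 1 + P.ε} :=
          closure_minimal (fun r hr => by
            simp only [hU, mem_setOf_eq] at hr ⊢
            exact hr.le) (isClosed_le hc continuous_const)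
        exact hsub hmem
      -- on `[a, b]` the capped function is `min A B`
      have hIcc : ∀ r ∈ Icc a b, P.capAux x' t (y₀ + r • e₁) = min (A r) (B r) := fun r hr => by
        rcases hr.1.lt_or_eq with hlt | heq
        · rcases hr.2.lt_or_eq with hlt' | heq'
          · exact hcapU r (hIoo ⟨hlt, hlt'⟩)
          · subst heq'
            rw [hcapUc _ hb_notMem, min_eq_left (hAleB _ hnorm_b hb_notMem)]
        · subst heq
          rw [hcapUc _ ha_notMem, min_eq_left (hAleB _ hnorm_a ha_notMem)]
      refine lipschitzWith_of_Iic_Icc_Ici hab ?_ ?_ ?_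
      · intro x hx y hy
        rw [hcapUc x (hle_of_notMem_left x hx), hcapUc y (hle_of_notMem_left y hy)]
        exact hA' x y
      · intro x hx y hy
        rw [hIcc x hx, hIcc y hy]
        exact hAB' x y
      · intro x hx y hy
        rw [hcapUc x (hge_of_notMem_right x hx), hcapUc y (hge_of_notMem_right y hy)]
        exact hA' x y
    · -- `U = ∅`: the capped function is `A`
      have hall : ∀ r, r ∉ U := fun r hr => hne ⟨r, hr⟩
      have heq : (fun r : ℝ => P.capAux x' t (y₀ + r • e₁)) = A := funext fun r => hcapUc r (hall r)
      rw [heq]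
      exact hA

end DeformData

end Literature.Barriers.AtomisticToContinuum.HardDisk

end
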